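import Mathlib
import Summits.AtomisticToContinuum.Crystallization.Theorems.SquareWellLayerCakeGapTwelveToBarlowNoSixCommonNeighbours

/-!
# Combinatorial layering (B1a of `GapTwelveToBarlow`): the link-edge budget of a Good site

Crux `SquareWellLayerCake.GapTwelveToBarlow` (stmt-AtomisticToContinuum-15807), line `Sketch`,
stub `stub_combinatorialLayering` (card B1a, energy-free).  The stub itself (deep all-Good,
five-fold-free balls are combinatorially Barlow-charted) is blocked on a one-shell enumeration
(`LinkDichotomyChart`, a thick version of Hales 2012 Theorem 3 + Lemma 9, not in the tree); this
file lands the elementary link-level facts that close now, in the stub's own vocabulary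
(`Fin N`-indexed configurations, `dist ≤ 1` bonds, the verbatim Good clauses):

* `common_le_five_of_localSep` — the SIGN LEMMA UNDER LOCAL SEPARATION: the landed
  `stub_noSixCommonNeighbours` asks for a globally `55/57`-separated configuration, whereas a Good
  site only separates its `11/10`-window from everything; re-indexing that window by `Fin M`
  transfers the bound: a bond `(j, k)` at a site `j` whose `11/10`-window is `55/57`-separated has
  at most five common neighbours within distance `1`.
* `common_le_four_of_localSep` — if moreover `(j, k)` is not a five-fold bond (the verbatim
  five-fold-freeness clause of the stub), it has at most FOUR common neighbours: every vertex of
  the link of `j` has link-degree `≤ 4`.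
* `stub_linkPairsLe48` (anchor) — at a site with the Good separation clause, exactly twelve
  neighbours within `1` and no five-fold bond, the ordered bonded pairs of distinct neighbours
  number at most `48 = 12 · 4`: the link graph of `j` has at most `24` edges (the cubocta /
  anticubocta value, where equality holds).

Mathlib + the landed sign lemma only; no named fact is used.
-/

noncomputable section

namespace Summit.AtomisticToContinuum.Crystallization.Theorems.SquareWellLayerCakeGapTwelveToBarlow

open Finset

/-- **Sign lemma under local separation.**  If the `11/10`-window of `x j` is `55/57`-separated
from everything (first Good clause at `j`), a bond `(j, k)` (`j ≠ k`, distance `≤ 1`) has at most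
five common neighbours within distance `1`.  Proof: re-index the window
`T = {l | dist (x j) (x l) ≤ 11/10}` by `Fin T.card`; the re-indexed configuration is globally
`55/57`-separated, contains `j`, `k` and every common neighbour, and the landed
`stub_noSixCommonNeighbours` applies to it. [folklore] -/
theorem common_le_five_of_localSep {N : ℕ} (x : Fin N → EuclideanSpace ℝ (Fin 3)) (j k : Fin N)
    (hsep : ∀ j' : Fin N, dist (x j) (x j') ≤ 11 / 10 → ∀ k' : Fin N, k' ≠ j' →
      (55 : ℝ) / 57 ≤ dist (x j') (x k'))
    (hjk : j ≠ k) (hd : dist (x j) (x k) ≤ 1) :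
    (Finset.univ.filter fun l : Fin N =>
      l ≠ j ∧ l ≠ k ∧ dist (x j) (x l) ≤ 1 ∧ dist (x k) (x l) ≤ 1).card ≤ 5 := by
  -- the window `T` of sites within `11/10` of `x j`
  obtain ⟨T, hT⟩ : ∃ T : Finset (Fin N),
      T = Finset.univ.filter fun l : Fin N => dist (x j) (x l) ≤ 11 / 10 := ⟨_, rfl⟩
  have hmemT : ∀ {l : Fin N}, l ∈ T ↔ dist (x j) (x l) ≤ 11 / 10 := by
    intro l
    rw [hT, Finset.mem_filter]
    simp
  have hjT : j ∈ T := hmemT.2 (by rw [dist_self]; norm_num)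
  have hkT : k ∈ T := hmemT.2 (hd.trans (by norm_num))
  -- re-index it by `Fin T.card`
  obtain ⟨e, he⟩ : ∃ e : Fin T.card ≃ {l // l ∈ T}, e = T.equivFin.symm := ⟨_, rfl⟩
  obtain ⟨y, hy⟩ : ∃ y : Fin T.card → EuclideanSpace ℝ (Fin 3), ∀ m, y m = x (e m) :=
    ⟨_, fun _ => rfl⟩
  -- the re-indexed window is globally separated
  have hysep : ∀ m m' : Fin T.card, m ≠ m' → (55 : ℝ) / 57 ≤ dist (y m) (y m') := by
    intro m m' hmm'
    have hne : ((e m' : {l // l ∈ T}) : Fin N) ≠ (e m : {l // l ∈ T}) := by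
      intro h
      exact hmm' (e.injective (Subtype.ext h)).symm
    rw [hy, hy]
    exact hsep _ (hmemT.1 (e m).2) _ hne
  -- the bond, re-indexed
  obtain ⟨j', hj'⟩ : ∃ j' : Fin T.card, j' = e.symm ⟨j, hjT⟩ := ⟨_, rfl⟩
  obtain ⟨k', hk'⟩ : ∃ k' : Fin T.card, k' = e.symm ⟨k, hkT⟩ := ⟨_, rfl⟩
  have hej : ((e j' : {l // l ∈ T}) : Fin N) = j := by rw [hj', Equiv.apply_symm_apply]
  have hek : ((e k' : {l // l ∈ T}) : Fin N) = k := by rw [hk', Equiv.apply_symm_apply]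
  have hjk' : j' ≠ k' := by
    intro h
    apply hjk
    rw [← hej, ← hek, h]
  have hd' : dist (y j') (y k') ≤ 1 := by
    rw [hy, hy, hej, hek]
    exact hd
  have h5 := stub_noSixCommonNeighbours T.card y j' k' hjk' hysep hd'
  -- the common neighbours of `(j, k)` are images of common neighbours of `(j', k')`
  have hsub : (Finset.univ.filter fun l : Fin N =>
        l ≠ j ∧ l ≠ k ∧ dist (x j) (x l) ≤ 1 ∧ dist (x k) (x l) ≤ 1) ⊆
      (Finset.univ.filter fun m : Fin T.card =>
        m ≠ j' ∧ m ≠ k' ∧ dist (y j') (y m) ≤ 1 ∧ dist (y k') (y m) ≤ 1).image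
        fun m => ((e m : {l // l ∈ T}) : Fin N) := by
    intro l hl
    rw [Finset.mem_filter] at hl
    obtain ⟨-, hlj, hlk, hjl, hkl⟩ := hl
    have hlT : l ∈ T := hmemT.2 (hjl.trans (by norm_num))
    rw [Finset.mem_image]
    refine ⟨e.symm ⟨l, hlT⟩, ?_, by rw [Equiv.apply_symm_apply]⟩
    rw [Finset.mem_filter]
    refine ⟨Finset.mem_univ _, ?_, ?_, ?_, ?_⟩
    · intro h
      apply hlj
      have h2 := congrArg (fun m : Fin T.card => ((e m : {l // l ∈ T}) : Fin N)) h
      simp only [Equiv.apply_symm_apply] at h2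
      rw [h2, hej]
    · intro h
      apply hlk
      have h2 := congrArg (fun m : Fin T.card => ((e m : {l // l ∈ T}) : Fin N)) h
      simp only [Equiv.apply_symm_apply] at h2
      rw [h2, hek]
    · rw [hy, hy, hej, Equiv.apply_symm_apply]
      exact hjl
    · rw [hy, hy, hek, Equiv.apply_symm_apply]
      exact hkl
  exact ((Finset.card_le_card hsub).trans Finset.card_image_le).trans h5

/-- **Link degrees are at most four at a five-fold-free bond.**  Under the local separation of
`common_le_five_of_localSep`, a bond `(j, k)` which is not a five-fold bond (verbatim clause of
`stub_combinatorialLayering`: not (`j ≠ k`, distance `≤ 1`, exactly five common neighbours)) has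
at most four common neighbours within distance `1`. [folklore] -/
theorem common_le_four_of_localSep {N : ℕ} (x : Fin N → EuclideanSpace ℝ (Fin 3)) (j k : Fin N)
    (hsep : ∀ j' : Fin N, dist (x j) (x j') ≤ 11 / 10 → ∀ k' : Fin N, k' ≠ j' →
      (55 : ℝ) / 57 ≤ dist (x j') (x k'))
    (hjk : j ≠ k) (hd : dist (x j) (x k) ≤ 1)
    (hff : ¬ (j ≠ k ∧ dist (x j) (x k) ≤ 1 ∧
      (Finset.univ.filter fun l : Fin N =>
        l ≠ j ∧ l ≠ k ∧ dist (x j) (x l) ≤ 1 ∧ dist (x k) (x l) ≤ 1).card = 5)) :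
    (Finset.univ.filter fun l : Fin N =>
      l ≠ j ∧ l ≠ k ∧ dist (x j) (x l) ≤ 1 ∧ dist (x k) (x l) ≤ 1).card ≤ 4 := by
  have h5 := common_le_five_of_localSep x j k hsep hjk hd
  have hne : (Finset.univ.filter fun l : Fin N =>
      l ≠ j ∧ l ≠ k ∧ dist (x j) (x l) ≤ 1 ∧ dist (x k) (x l) ≤ 1).card ≠ 5 :=
    fun h => hff ⟨hjk, hd, h⟩
  omega

/-- **Anchor (B1a partial, LINK-EDGE BUDGET).**  At a site `j` whose `11/10`-window is
`55/57`-separated from everything, with exactly twelve other sites within distance `1` and no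
five-fold bond at `j` (the verbatim clauses of `stub_combinatorialLayering`), the ordered pairs
`(k, l)` of distinct neighbours of `j` that are bonded to each other number at most `48`: the
link graph of `j` (twelve vertices) has at most `24` edges, since every vertex `k` of the link
has link-degree `= #(common neighbours of the bond (j, k)) ≤ 4` (`common_le_four_of_localSep`).
[folklore] -/
theorem stub_linkPairsLe48 :
    ∀ (N : ℕ) (x : Fin N → EuclideanSpace ℝ (Fin 3)) (j : Fin N),
      (∀ j' : Fin N, dist (x j) (x j') ≤ 11 / 10 → ∀ k' : Fin N, k' ≠ j' →
          (55 : ℝ) / 57 ≤ dist (x j') (x k')) →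
      (Finset.univ.filter fun j' : Fin N => j' ≠ j ∧ dist (x j) (x j') ≤ 1).card = 12 →
      (∀ k : Fin N, ¬ (j ≠ k ∧ dist (x j) (x k) ≤ 1 ∧
        (Finset.univ.filter fun l : Fin N =>
          l ≠ j ∧ l ≠ k ∧ dist (x j) (x l) ≤ 1 ∧ dist (x k) (x l) ≤ 1).card = 5)) →
      (Finset.univ.filter fun p : Fin N × Fin N => p.1 ≠ j ∧ p.2 ≠ j ∧ p.1 ≠ p.2 ∧
        dist (x j) (x p.1) ≤ 1 ∧ dist (x j) (x p.2) ≤ 1 ∧ dist (x p.1) (x p.2) ≤ 1).card ≤ 48 := by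
  intro N x j hsep h12 hff
  -- the neighbours of `j` and the common-neighbour sets of its bonds
  obtain ⟨nb, hnb⟩ : ∃ nb : Finset (Fin N),
      nb = Finset.univ.filter fun j' : Fin N => j' ≠ j ∧ dist (x j) (x j') ≤ 1 := ⟨_, rfl⟩
  obtain ⟨cm, hcm⟩ : ∃ cm : Fin N → Finset (Fin N), ∀ k, cm k = Finset.univ.filter fun l : Fin N =>
      l ≠ j ∧ l ≠ k ∧ dist (x j) (x l) ≤ 1 ∧ dist (x k) (x l) ≤ 1 := ⟨_, fun _ => rfl⟩
  rw [← hnb] at h12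
  have hcm4 : ∀ k ∈ nb, (cm k).card ≤ 4 := by
    intro k hk
    rw [hnb, Finset.mem_filter] at hk
    obtain ⟨-, hkj, hdk⟩ := hk
    rw [hcm]
    exact common_le_four_of_localSep x j k hsep (Ne.symm hkj) hdk (hff k)
  -- every bonded ordered pair of neighbours `(k, l)` has `l` a common neighbour of `(j, k)`
  have hsub : (Finset.univ.filter fun p : Fin N × Fin N => p.1 ≠ j ∧ p.2 ≠ j ∧ p.1 ≠ p.2 ∧
        dist (x j) (x p.1) ≤ 1 ∧ dist (x j) (x p.2) ≤ 1 ∧ dist (x p.1) (x p.2) ≤ 1) ⊆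
      nb.biUnion fun k => (cm k).image fun l => (k, l) := by
    intro p hp
    rw [Finset.mem_filter] at hp
    obtain ⟨-, h1j, h2j, h12', hd1, hd2, hd12⟩ := hp
    rw [Finset.mem_biUnion]
    refine ⟨p.1, ?_, ?_⟩
    · rw [hnb, Finset.mem_filter]
      exact ⟨Finset.mem_univ _, h1j, hd1⟩
    · rw [Finset.mem_image]
      refine ⟨p.2, ?_, Prod.mk.eta⟩
      rw [hcm, Finset.mem_filter]
      exact ⟨Finset.mem_univ _, h2j, Ne.symm h12', hd2, hd12⟩
  calc (Finset.univ.filter fun p : Fin N × Fin N => p.1 ≠ j ∧ p.2 ≠ j ∧ p.1 ≠ p.2 ∧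
          dist (x j) (x p.1) ≤ 1 ∧ dist (x j) (x p.2) ≤ 1 ∧ dist (x p.1) (x p.2) ≤ 1).card
      ≤ (nb.biUnion fun k => (cm k).image fun l => (k, l)).card := Finset.card_le_card hsub
    _ ≤ ∑ k ∈ nb, ((cm k).image fun l => (k, l)).card := Finset.card_biUnion_le
    _ ≤ ∑ k ∈ nb, 4 :=
        Finset.sum_le_sum fun k hk => Finset.card_image_le.trans (hcm4 k hk)
    _ = 48 := by rw [Finset.sum_const, smul_eq_mul, h12]

end Summit.AtomisticToContinuum.Crystallization.Theorems.SquareWellLayerCakeGapTwelveToBarlow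

end
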